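/-
Copyright (c) 2026. All rights reserved.
Released under Apache 2.0 license as described in the file LICENSE.
-/
import Summits.HubbardSuperconductivity.HubbardLadder.HubbardRowsOfClaims
import Literature.MathematicalPhysics.QuantumLattice.HubbardOneBodyDensityMatrix
import Literature.MathematicalPhysics.QuantumLattice.HubbardDoubleOccupancyBounds
import HarnessLib

/-!
# R2 rows: the one-body density matrix, the momentum-distribution sum rule and certified brackets on the
# kinetic energy and the nearest-neighbour hopping amplitude of the half-filled `4 × 4` Hubbard torus (device D11)

HONEST FRAMING: ladder R1–R4 with certified numbers; no claim on H/H₀.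

Device D11 (`Literature/…/HubbardOneBodyDensityMatrix`, all PROVED there; Lieb–Loss–McCann 1993, Theorem
eqs. (5)–(6), ground-state case): the unique half-filled ground state `ψ` of the repulsive Hubbard model on a
connected balanced bipartite graph has a REAL SYMMETRIC one-body density matrix
`G_{στ}(x,y) := ⟨ψ, c†_{xσ} c_{yτ} ψ⟩` with `G_{σσ}(x,x) = ½‖ψ‖²` and `G_{στ}(x,y) = 0` whenever
`(x,σ) ≠ (y,τ)` lie on the SAME sublattice. On the `4 × 4` torus (`t = 1`, `N = 16`, every `U > 0`) this file
records, as plain theorems about `ψ`: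

* B8.z  `⟨c†_{xσ} c_{yτ}⟩ = 0` for `(x,σ) ≠ (y,τ)` with `(-1)^{x₁+x₂} = (-1)^{y₁+y₂}`; in particular
  `⟨c†_{xσ} c_{x+r,σ}⟩ = 0` for the seven even displacements `r ≠ 0` (`r₁ + r₂` even);
* B8.r  `G` is real and symmetric: `conj G_{στ}(x,y) = G_{στ}(x,y) = G_{τσ}(y,x)`;
* B8.m  the momentum-distribution sum rule `Σ_r f(r) (1 + ε_r) Σ_x G_σ(x,x+r) = 16 f(0)` for every test
  function `f` (with `f(r) = e^{ik·r}/16` this reads `n_σ(k) + n_σ(k+(π,π)) = 1`, OBSERVABLES.md §5d);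
* B8.K  the kinetic energy per site `k := Re⟨ψ, H(1,0) ψ⟩/16 = e(U) - U d` (Hellmann–Feynman split) obeys
  the CERTIFICATE-FREE floor `k ≥ -3/2` (variational, free-fermion value) and, composed with the typed claim
  nodes of `Bounds/TorusSectorLowerRows` (INHERITED pub-mbboot sector SDP lower certificates, LEAN REQUEST
  #39.2) and `Bounds/TorusRayleighUpperRows` (INHERITED E2 Rayleigh upper certificates, LEAN REQUEST #48), the
  brackets `k ∈ [-1.5000, -1.3748] (U=2), [-1.4200, -1.1649] (U=4), [-1.3132, -0.9431] (U=6),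
  [-1.1904, -0.7848] (U=8)` — from the supergradient inequalities
  `(U₂ E(U) - U E(U₂))/(U₂ - U) ≥ K ≥ (U E(U₁) - U₁ E(U))/(U - U₁)` (`0 ≤ U₁ < U < U₂`), which are
  sharper than `e - U d` with the `d` brackets of `HubbardRowsOfClaims` by exactly `e_hi - e_lo`;
* B8.g  the bond-and-spin averaged nearest-neighbour hopping amplitude
  `ḡ := (1/128) Σ_σ Σ_{(x,y) ordered n.n.} ⟨c†_{xσ} c_{yσ}⟩ = -k/8 ∈ [0.1718, 0.1875] (U=2), [0.1456, 0.1775]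
  (U=4), [0.1178, 0.1642] (U=6), [0.0981, 0.1488] (U=8)`.

HONEST LIMITS: half filling and `t' = 0` only (the zero rows are the bipartite particle–hole selection rule and
fail at any doping or with `t' ≠ 0`); the kinetic brackets are `O(e_hi - e_lo)` wide (the INHERITED sector-SDP
lower nodes sit `0.15–0.57` below the E2 upper nodes in total energy) and say nothing about `n_σ(k)` at an
individual momentum beyond the exact pairing `k ↔ k + (π,π)`; no individual bond is bracketed, only the
bond–spin average (translation/rotation covariance of the unique ground state is not formalised here). The E2
upper nodes agree with the exact-diagonalisation energies of the `4 × 4` torus (Fano–Ortolani–Parola 1990;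
Dagotto 1994, §III) to the displayed digits; no held source tabulates `k` itself for this cluster, so row B8.K
is recorded in R2-TABLE.md without a published comparison value.

## References
* E. H. Lieb, M. Loss, R. J. McCann, J. Math. Phys. 34 (1993) 891, Theorem eqs. (5), (6). [cite: LiebLossMccann1993, Theorem eqs. (5)-(6)]
* E. H. Lieb, Phys. Rev. Lett. 62 (1989) 1201, Theorem 2. [cite: LiebPRL1989, Theorem 2]
* T. Koma, H. Tasaki, J. Stat. Phys. 76 (1994) 745, §1 (supergradient of `E(U)`). [cite: KomaTasaki1994, §1]
* H. Tasaki, *Physics and Mathematics of Quantum Many-Body Systems* (2020), §2.1, §9.3. [cite: Tasaki2020, §2.1]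
* G. Fano, F. Ortolani, A. Parola, Phys. Rev. B 42 (1990) 6877 (4 × 4 exact diagonalisation). [cite: FanoOrtolaniParola1990]
* E. Dagotto, Rev. Mod. Phys. 66 (1994) 763, §III. [cite: Dagotto1994, §III]
-/

noncomputable section

namespace Summit.HubbardSuperconductivity.HubbardLadder

open Literature.MathematicalPhysics.QuantumLattice Matrix

open Bounds

/-! ### Kernel: the kinetic energy of a ground state from energy bounds (any graph) -/

section Kernel

variable {Λ : Type*} [LinearOrder Λ] [Fintype Λ] (G : SimpleGraph Λ) [DecidableRel G.Adj]

/-- **Hellmann–Feynman split**: in a normalised ground state of `H(t,U)`,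
`Re⟨ψ, H(t,0) ψ⟩ = E_N(t,U) - U Re⟨ψ, D̂ ψ⟩`. [cite: KomaTasaki1994, §1] -/
theorem re_expect_kinetic_eq (t U : ℝ) {N : ℕ} {ψ : Fock (Orb Λ)}
    (hψ : IsGroundState (hamiltonian G t U) N ψ) (hψ1 : star ψ ⬝ᵥ ψ = 1) :
    (expect (hamiltonian G t 0) ψ).re =
      groundEnergyAt G t U N - U * (expect (∑ x : Λ, numberOp x 0 * numberOp x 1) ψ).re := by
  rw [DoubleOccupancy.re_expect_hamiltonian_eq G t U 0 ψ,
    DoubleOccupancy.re_expect_of_isGroundState G t U hψ hψ1]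
  ring

/-- **Variational floor**: `E_N(t,0) ≤ Re⟨ψ, H(t,0) ψ⟩` for every normalised `N`-particle `ψ`.
[cite: Tasaki2020, §2.1] -/
theorem groundEnergyAt_zero_le_re_expect_kinetic (t : ℝ) {N : ℕ} {ψ : Fock (Orb Λ)}
    (hN : IsNParticle N ψ) (hψ1 : star ψ ⬝ᵥ ψ = 1) :
    groundEnergyAt G t 0 N ≤ (expect (hamiltonian G t 0) ψ).re := by
  unfold groundEnergyAt
  exact LiebThm1.groundEnergy_le_re_expect (hamiltonian G t 0) hN hψ1

/-- **Kinetic ceiling from energy bounds**: if `0 ≤ U < U₂`, `E_N(U) ≤ R` and `L₂ ≤ E_N(U₂)` then every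
normalised ground state of `H(t,U)` has `Re⟨ψ, H(t,0) ψ⟩ ≤ (U₂ R - U L₂)/(U₂ - U)` (supergradient
`E(U₂) - E(U) ≤ (U₂ - U)⟨D̂⟩`). [cite: KomaTasaki1994, §1] -/
theorem re_expect_kinetic_le_of_bounds (t U : ℝ) {N : ℕ} {ψ : Fock (Orb Λ)}
    (hψ : IsGroundState (hamiltonian G t U) N ψ) (hψ1 : star ψ ⬝ᵥ ψ = 1) {U₂ R L₂ : ℝ} (hU : 0 ≤ U)
    (hU₂ : U < U₂) (hR : groundEnergyAt G t U N ≤ R) (hL₂ : L₂ ≤ groundEnergyAt G t U₂ N) :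
    (expect (hamiltonian G t 0) ψ).re ≤ (U₂ * R - U * L₂) / (U₂ - U) := by
  have h := DoubleOccupancy.groundEnergyAt_sub_le_mul_doubleOcc G t U U₂ hψ hψ1
  have h' := mul_le_mul_of_nonneg_left h hU
  have hR' := mul_le_mul_of_nonneg_left hR (hU.trans hU₂.le)
  have hL' := mul_le_mul_of_nonneg_left hL₂ hU
  rw [re_expect_kinetic_eq G t U hψ hψ1, le_div_iff₀ (sub_pos.2 hU₂)]
  nlinarith [h', hR', hL']

/-- **Kinetic floor from energy bounds**: if `0 ≤ U₁ < U`, `L₁ ≤ E_N(U₁)` and `E_N(U) ≤ R` then every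
normalised ground state of `H(t,U)` has `(U L₁ - U₁ R)/(U - U₁) ≤ Re⟨ψ, H(t,0) ψ⟩` (supergradient
`(U - U₁)⟨D̂⟩ ≤ E(U) - E(U₁)`). [cite: KomaTasaki1994, §1] -/
theorem le_re_expect_kinetic_of_bounds (t U : ℝ) {N : ℕ} {ψ : Fock (Orb Λ)}
    (hψ : IsGroundState (hamiltonian G t U) N ψ) (hψ1 : star ψ ⬝ᵥ ψ = 1) {U₁ L₁ R : ℝ} (hU₁ : 0 ≤ U₁)
    (hU : U₁ < U) (hL₁ : L₁ ≤ groundEnergyAt G t U₁ N) (hR : groundEnergyAt G t U N ≤ R) :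
    (U * L₁ - U₁ * R) / (U - U₁) ≤ (expect (hamiltonian G t 0) ψ).re := by
  have h := DoubleOccupancy.groundEnergyAt_sub_le_mul_doubleOcc G t U U₁ hψ hψ1
  have hU0 : 0 ≤ U := hU₁.trans hU.le
  have h' := mul_le_mul_of_nonneg_left h hU0
  have hR' := mul_le_mul_of_nonneg_left hR hU₁
  have hL' := mul_le_mul_of_nonneg_left hL₁ hU0
  rw [re_expect_kinetic_eq G t U hψ hψ1, div_le_iff₀ (sub_pos.2 hU)]
  nlinarith [h', hR', hL']

/-- **Bond sum = minus the kinetic energy** (`t = 1`): `Σ_x Σ_y Σ_σ [x ~ y] ⟨c†_{xσ} c_{yσ}⟩ = -⟨ψ, H(1,0) ψ⟩`.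
[cite: LiebLossMccann1993, Theorem eqs. (5)-(6)] -/
theorem bondSum_eq_neg_expect_kinetic (φ : Fock (Orb Λ)) :
    (∑ x : Λ, ∑ y : Λ, ∑ σ : Fin 2,
        if G.Adj x y then expect (creation (orb x σ) * annihilation (orb y σ)) φ else 0) =
      -expect (hamiltonian G 1 0) φ := by
  rw [expect_hamiltonian_zero_eq_sum G 1 φ, Complex.ofReal_one, neg_mul, one_mul, neg_neg]

end Kernel

/-! ### Certificate-free rows on the `4 × 4` torus (every `U > 0`): Lieb–Loss–McCann zeros, reality, sum rule -/

/-- **R2 row B8.z (every `U > 0`)**: `⟨ψ, c†_{xσ} c_{yτ} ψ⟩ = 0` whenever `(x,σ) ≠ (y,τ)` and `x`, `y` lie on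
the same sublattice of the `4 × 4` torus (`(-1)^{x₁+x₂} = (-1)^{y₁+y₂}`).
[cite: LiebLossMccann1993, Theorem eq. (6)] -/
theorem oneBody_four_eq_zero_of_sameSublattice {U : ℝ} (hU : 0 < U) {ψ : Fock (Orb (FermionTorus 2 4))}
    (hψ : IsGroundState (hamiltonian (fermionTorusGraph 2 4) 1 U) 16 ψ) {x y : FermionTorus 2 4}
    {σ τ : Fin 2} (hne : orb x σ ≠ orb y τ) (hxy : torusStagger x = torusStagger y) :
    expect (creation (orb x σ) * annihilation (orb y τ)) ψ = 0 := by
  have hψ' : IsGroundState (hamiltonian (fermionTorusGraph 2 4) 1 U) (4 ^ 2) ψ := by simpa using hψ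
  exact hubbardTorus_expect_creation_mul_annihilation_eq_zero (L := 4) (by decide) one_ne_zero hU hψ' hne
    hxy

/-- **R2 row B8.z′ (every `U > 0`)**: for each of the seven even displacements `r ≠ 0` of the `4 × 4` torus
(`(-1)^{r₁+r₂} = 1`: `r ∈ {(1,1),(1,3),(3,1),(3,3),(2,0),(0,2),(2,2)}`) and every site and spin,
`⟨ψ, c†_{xσ} c_{x+r,σ} ψ⟩ = 0`. [cite: LiebLossMccann1993, Theorem eq. (6)] -/
theorem oneBody_four_translate_eq_zero {U : ℝ} (hU : 0 < U) {ψ : Fock (Orb (FermionTorus 2 4))}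
    (hψ : IsGroundState (hamiltonian (fermionTorusGraph 2 4) 1 U) 16 ψ) {r : FermionTorus 2 4}
    (hr0 : r ≠ 0) (hr : torusStagger r = 1) (x : FermionTorus 2 4) (σ : Fin 2) :
    expect (creation (orb x σ) * annihilation (orb (x + r) σ)) ψ = 0 := by
  have hψ' : IsGroundState (hamiltonian (fermionTorusGraph 2 4) 1 U) (4 ^ 2) ψ := by simpa using hψ
  exact hubbardTorus_expect_creation_mul_annihilation_translate_eq_zero (L := 4) (by decide) one_ne_zero
    hU hψ' hr0 hr x σ

/-- **R2 row B8.r (every `U > 0`)**: the one-body density matrix of the `4 × 4` half-filled ground state is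
real and symmetric: `conj ⟨c†_a c_b⟩ = ⟨c†_a c_b⟩ = ⟨c†_b c_a⟩` for all spin-orbitals `a`, `b`.
[cite: LiebLossMccann1993, Theorem (real case)] -/
theorem oneBody_four_real_symm {U : ℝ} (hU : 0 < U) {ψ : Fock (Orb (FermionTorus 2 4))}
    (hψ : IsGroundState (hamiltonian (fermionTorusGraph 2 4) 1 U) 16 ψ) (a b : Orb (FermionTorus 2 4)) :
    star (expect (creation a * annihilation b) ψ) = expect (creation a * annihilation b) ψ ∧
      expect (creation a * annihilation b) ψ = expect (creation b * annihilation a) ψ := by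
  have hψ' : IsGroundState (hamiltonian (fermionTorusGraph 2 4) 1 U) (4 ^ 2) ψ := by simpa using hψ
  exact hubbardTorus_expect_creation_mul_annihilation_real_symm (L := 4) (by decide) one_ne_zero hU hψ' a b

/-- **R2 row B8.n (every `U > 0`)**: the diagonal, `⟨ψ, c†_{xσ} c_{xσ} ψ⟩ = ½` in a unit ground state.
[cite: LiebLossMccann1993, Theorem eq. (5)] -/
theorem oneBody_four_diag_eq_half {U : ℝ} (hU : 0 < U) {ψ : Fock (Orb (FermionTorus 2 4))}
    (hψ : IsGroundState (hamiltonian (fermionTorusGraph 2 4) 1 U) 16 ψ) (hψ1 : star ψ ⬝ᵥ ψ = 1)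
    (x : FermionTorus 2 4) (σ : Fin 2) :
    expect (creation (orb x σ) * annihilation (orb x σ)) ψ = 1 / 2 := by
  have hψ' : IsGroundState (hamiltonian (fermionTorusGraph 2 4) 1 U) (4 ^ 2) ψ := by simpa using hψ
  rw [hubbardTorus_expect_numberAt_eq_half' (L := 4) (by decide) one_ne_zero hU hψ' x σ, hψ1, mul_one]

/-- **R2 row B8.m (every `U > 0`)**: the even-part momentum sum rule. For every `f : (ℤ/4ℤ)² → ℂ`,
`Σ_r f(r) (1 + (-1)^{r₁+r₂}) Σ_x ⟨c†_{xσ} c_{x+r,σ}⟩ = 16 f(0)` in a unit ground state; with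
`f(r) = e^{ik·r}/16` this is `n_σ(k) + n_σ(k + (π,π)) = 1` for every lattice momentum `k`.
[cite: LiebLossMccann1993, Theorem eqs. (5)-(6)] -/
theorem oneBody_four_even_sumRule {U : ℝ} (hU : 0 < U) {ψ : Fock (Orb (FermionTorus 2 4))}
    (hψ : IsGroundState (hamiltonian (fermionTorusGraph 2 4) 1 U) 16 ψ) (hψ1 : star ψ ⬝ᵥ ψ = 1)
    (σ : Fin 2) (f : FermionTorus 2 4 → ℂ) :
    ∑ r : FermionTorus 2 4, f r * (1 + ((torusStagger r : ℤ) : ℂ)) *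
        ∑ x : FermionTorus 2 4, expect (creation (orb x σ) * annihilation (orb (x + r) σ)) ψ =
      16 * f 0 := by
  have hψ' : IsGroundState (hamiltonian (fermionTorusGraph 2 4) 1 U) (4 ^ 2) ψ := by simpa using hψ
  rw [hubbardTorus_sum_even_translate_oneBody_eq (L := 4) (by decide) one_ne_zero hU hψ' σ f, hψ1, mul_one]
  norm_num

/-- **R2 row B8.K₀ (every `U`, certificate-free)**: the kinetic energy per site of any unit `16`-particle vector
on the `4 × 4` torus is at least the free-fermion value, `Re⟨ψ, H(1,0) ψ⟩/16 ≥ -3/2`.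
[cite: Tasaki2020, §2.1] -/
theorem kineticPerSite_four_ge_free {ψ : Fock (Orb (FermionTorus 2 4))} (hN : IsNParticle 16 ψ)
    (hψ1 : star ψ ⬝ᵥ ψ = 1) : (-3 / 2 : ℝ) ≤ (expect (hamiltonian (fermionTorusGraph 2 4) 1 0) ψ).re / 16 := by
  have h := groundEnergyAt_zero_le_re_expect_kinetic (fermionTorusGraph 2 4) 1 hN hψ1
  have h0 := groundEnergyAt_four_halfFilling_U0_ge
  rw [le_div_iff₀ (by norm_num : (0 : ℝ) < 16)]
  linarith

/-- **R2 row B8.g₀ (every `U`)**: the bond sum of the one-body density matrix is minus the kinetic energy,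
`Σ_σ Σ_{x ~ y} ⟨c†_{xσ} c_{yσ}⟩ = -⟨ψ, H(1,0) ψ⟩` (128 ordered bond–spin pairs on the `4 × 4` torus).
[cite: LiebLossMccann1993, Theorem eqs. (5)-(6)] -/
theorem bondSum_four_eq_neg_kinetic (ψ : Fock (Orb (FermionTorus 2 4))) :
    (∑ x : FermionTorus 2 4, ∑ y : FermionTorus 2 4, ∑ σ : Fin 2,
        if (fermionTorusGraph 2 4).Adj x y then expect (creation (orb x σ) * annihilation (orb y σ)) ψ
        else 0) = -expect (hamiltonian (fermionTorusGraph 2 4) 1 0) ψ :=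
  bondSum_eq_neg_expect_kinetic (fermionTorusGraph 2 4) ψ

/-! ### Claim-form rows: kinetic energy per site `k = Re⟨H(1,0)⟩/16` and bond average `ḡ = -k/8` -/

/-- From a bracket on `Re⟨ψ, H(1,0) ψ⟩/16` to the bracket on the bond average
`Re(Σ_σ Σ_{x ~ y} ⟨c†_{xσ} c_{yσ}⟩)/128 = -k/8`. [cite: LiebLossMccann1993, Theorem eqs. (5)-(6)] -/
theorem bondAvg_four_mem_Icc_of_kinetic {ψ : Fock (Orb (FermionTorus 2 4))} {lo hi : ℝ}
    (h : (expect (hamiltonian (fermionTorusGraph 2 4) 1 0) ψ).re / 16 ∈ Set.Icc lo hi) :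
    (∑ x : FermionTorus 2 4, ∑ y : FermionTorus 2 4, ∑ σ : Fin 2,
        if (fermionTorusGraph 2 4).Adj x y then expect (creation (orb x σ) * annihilation (orb y σ)) ψ
        else 0).re / 128 ∈ Set.Icc (-hi / 8) (-lo / 8) := by
  rw [bondSum_four_eq_neg_kinetic, Complex.neg_re]
  obtain ⟨h1, h2⟩ := h
  constructor <;> linarith

/-- **R2 row B8a.K at `U = 2`, claim form** (2 nodes: E2 upper at `U = 2`, lower at `U = 4`;
variational free-fermion floor `E_16(0) ≥ -24`): kinetic energy per site `Re⟨ψ, H(1,0) ψ⟩/16 ∈ [-1.5000, -1.3748]`.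
[cite: KomaTasaki1994, §1] -/
theorem kineticPerSite_four_U2_mem_Icc_of_claims {ψ : Fock (Orb (FermionTorus 2 4))}
    (hψ : IsGroundState (hamiltonian (fermionTorusGraph 2 4) 1 2) 16 ψ) (hψ1 : star ψ ⬝ᵥ ψ = 1)
    (h₂ : torusUpper_mbbootE2_4x4_U2_N16)
    (h₄ : torusLower_mbboot_4x4_U4_N16) :
    (expect (hamiltonian (fermionTorusGraph 2 4) 1 0) ψ).re / 16 ∈ Set.Icc (-1.5000 : ℝ) (-1.3748) := by
  constructor
  · have hlo := kineticPerSite_four_ge_free hψ.1 hψ1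
    rw [le_div_iff₀ (by norm_num : (0 : ℝ) < 16)] at hlo ⊢
    linarith
  · have hup := re_expect_kinetic_le_of_bounds (fermionTorusGraph 2 4) 1 2 hψ hψ1
      (by norm_num : (0 : ℝ) ≤ 2) (by norm_num : (2 : ℝ) < 4) (groundEnergyAt_4x4_U2_N16_le_decimal h₂)
      (groundEnergyAt_4x4_U4_N16_ge_decimal h₄)
    rw [div_le_iff₀ (by norm_num : (0 : ℝ) < 16)]
    refine hup.trans ?_
    norm_num

/-- **R2 row B8a.g at `U = 2`, claim form** (same nodes): bond–spin averaged nearest-neighbour hopping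
amplitude `Re(Σ_σ Σ_{x ~ y} ⟨c†_{xσ} c_{yσ}⟩)/128 ∈ [0.1718, 0.1875]`. [cite: LiebLossMccann1993, Theorem eqs. (5)-(6)]
[cite: KomaTasaki1994, §1] -/
theorem bondAvg_four_U2_mem_Icc_of_claims {ψ : Fock (Orb (FermionTorus 2 4))}
    (hψ : IsGroundState (hamiltonian (fermionTorusGraph 2 4) 1 2) 16 ψ) (hψ1 : star ψ ⬝ᵥ ψ = 1)
    (h₂ : torusUpper_mbbootE2_4x4_U2_N16)
    (h₄ : torusLower_mbboot_4x4_U4_N16) :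
    (∑ x : FermionTorus 2 4, ∑ y : FermionTorus 2 4, ∑ σ : Fin 2,
        if (fermionTorusGraph 2 4).Adj x y then expect (creation (orb x σ) * annihilation (orb y σ)) ψ
        else 0).re / 128 ∈ Set.Icc (0.1718 : ℝ) 0.1875 := by
  have h := bondAvg_four_mem_Icc_of_kinetic (kineticPerSite_four_U2_mem_Icc_of_claims hψ hψ1 h₂ h₄)
  exact ⟨le_trans (by norm_num) h.1, le_trans h.2 (by norm_num)⟩

/-- **R2 row B8.K at `U = 4`, claim form** (3 nodes: E2 upper at `U = 4`, lower at `U = 6`;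
lower node at `U = 2`): kinetic energy per site `Re⟨ψ, H(1,0) ψ⟩/16 ∈ [-1.4200, -1.1649]`.
[cite: KomaTasaki1994, §1] -/
theorem kineticPerSite_four_U4_mem_Icc_of_claims {ψ : Fock (Orb (FermionTorus 2 4))}
    (hψ : IsGroundState (hamiltonian (fermionTorusGraph 2 4) 1 4) 16 ψ) (hψ1 : star ψ ⬝ᵥ ψ = 1)
    (h₂ : torusLower_mbboot_4x4_U2_N16)
    (h₄ : torusUpper_mbbootE2_4x4_U4_N16)
    (h₆ : torusLower_mbboot_4x4_U6_N16) :
    (expect (hamiltonian (fermionTorusGraph 2 4) 1 0) ψ).re / 16 ∈ Set.Icc (-1.4200 : ℝ) (-1.1649) := by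
  constructor
  · have hlo := le_re_expect_kinetic_of_bounds (fermionTorusGraph 2 4) 1 4 hψ hψ1
      (by norm_num : (0 : ℝ) ≤ 2) (by norm_num : (2 : ℝ) < 4) (groundEnergyAt_4x4_U2_N16_ge_decimal h₂)
      (groundEnergyAt_4x4_U4_N16_le_decimal h₄)
    rw [le_div_iff₀ (by norm_num : (0 : ℝ) < 16)]
    refine le_trans ?_ hlo
    norm_num
  · have hup := re_expect_kinetic_le_of_bounds (fermionTorusGraph 2 4) 1 4 hψ hψ1
      (by norm_num : (0 : ℝ) ≤ 4) (by norm_num : (4 : ℝ) < 6) (groundEnergyAt_4x4_U4_N16_le_decimal h₄)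
      (groundEnergyAt_4x4_U6_N16_ge_decimal h₆)
    rw [div_le_iff₀ (by norm_num : (0 : ℝ) < 16)]
    refine hup.trans ?_
    norm_num

/-- **R2 row B8.g at `U = 4`, claim form** (same nodes): bond–spin averaged nearest-neighbour hopping
amplitude `Re(Σ_σ Σ_{x ~ y} ⟨c†_{xσ} c_{yσ}⟩)/128 ∈ [0.1456, 0.1775]`. [cite: LiebLossMccann1993, Theorem eqs. (5)-(6)]
[cite: KomaTasaki1994, §1] -/
theorem bondAvg_four_U4_mem_Icc_of_claims {ψ : Fock (Orb (FermionTorus 2 4))}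
    (hψ : IsGroundState (hamiltonian (fermionTorusGraph 2 4) 1 4) 16 ψ) (hψ1 : star ψ ⬝ᵥ ψ = 1)
    (h₂ : torusLower_mbboot_4x4_U2_N16)
    (h₄ : torusUpper_mbbootE2_4x4_U4_N16)
    (h₆ : torusLower_mbboot_4x4_U6_N16) :
    (∑ x : FermionTorus 2 4, ∑ y : FermionTorus 2 4, ∑ σ : Fin 2,
        if (fermionTorusGraph 2 4).Adj x y then expect (creation (orb x σ) * annihilation (orb y σ)) ψ
        else 0).re / 128 ∈ Set.Icc (0.1456 : ℝ) 0.1775 := by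
  have h := bondAvg_four_mem_Icc_of_kinetic (kineticPerSite_four_U4_mem_Icc_of_claims hψ hψ1 h₂ h₄ h₆)
  exact ⟨le_trans (by norm_num) h.1, le_trans h.2 (by norm_num)⟩

/-- **R2 row B8b.K at `U = 6`, claim form** (3 nodes: E2 upper at `U = 6`, lower at `U = 8`;
lower node at `U = 4`): kinetic energy per site `Re⟨ψ, H(1,0) ψ⟩/16 ∈ [-1.3132, -0.9431]`.
[cite: KomaTasaki1994, §1] -/
theorem kineticPerSite_four_U6_mem_Icc_of_claims {ψ : Fock (Orb (FermionTorus 2 4))}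
    (hψ : IsGroundState (hamiltonian (fermionTorusGraph 2 4) 1 6) 16 ψ) (hψ1 : star ψ ⬝ᵥ ψ = 1)
    (h₄ : torusLower_mbboot_4x4_U4_N16)
    (h₆ : torusUpper_mbbootE2_4x4_U6_N16)
    (h₈ : torusLower_mbboot_4x4_U8_N16) :
    (expect (hamiltonian (fermionTorusGraph 2 4) 1 0) ψ).re / 16 ∈ Set.Icc (-1.3132 : ℝ) (-0.9431) := by
  constructor
  · have hlo := le_re_expect_kinetic_of_bounds (fermionTorusGraph 2 4) 1 6 hψ hψ1
      (by norm_num : (0 : ℝ) ≤ 4) (by norm_num : (4 : ℝ) < 6) (groundEnergyAt_4x4_U4_N16_ge_decimal h₄)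
      (groundEnergyAt_4x4_U6_N16_le_decimal h₆)
    rw [le_div_iff₀ (by norm_num : (0 : ℝ) < 16)]
    refine le_trans ?_ hlo
    norm_num
  · have hup := re_expect_kinetic_le_of_bounds (fermionTorusGraph 2 4) 1 6 hψ hψ1
      (by norm_num : (0 : ℝ) ≤ 6) (by norm_num : (6 : ℝ) < 8) (groundEnergyAt_4x4_U6_N16_le_decimal h₆)
      (groundEnergyAt_4x4_U8_N16_ge_decimal h₈)
    rw [div_le_iff₀ (by norm_num : (0 : ℝ) < 16)]
    refine hup.trans ?_
    norm_num

/-- **R2 row B8b.g at `U = 6`, claim form** (same nodes): bond–spin averaged nearest-neighbour hopping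
amplitude `Re(Σ_σ Σ_{x ~ y} ⟨c†_{xσ} c_{yσ}⟩)/128 ∈ [0.1178, 0.1642]`. [cite: LiebLossMccann1993, Theorem eqs. (5)-(6)]
[cite: KomaTasaki1994, §1] -/
theorem bondAvg_four_U6_mem_Icc_of_claims {ψ : Fock (Orb (FermionTorus 2 4))}
    (hψ : IsGroundState (hamiltonian (fermionTorusGraph 2 4) 1 6) 16 ψ) (hψ1 : star ψ ⬝ᵥ ψ = 1)
    (h₄ : torusLower_mbboot_4x4_U4_N16)
    (h₆ : torusUpper_mbbootE2_4x4_U6_N16)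
    (h₈ : torusLower_mbboot_4x4_U8_N16) :
    (∑ x : FermionTorus 2 4, ∑ y : FermionTorus 2 4, ∑ σ : Fin 2,
        if (fermionTorusGraph 2 4).Adj x y then expect (creation (orb x σ) * annihilation (orb y σ)) ψ
        else 0).re / 128 ∈ Set.Icc (0.1178 : ℝ) 0.1642 := by
  have h := bondAvg_four_mem_Icc_of_kinetic (kineticPerSite_four_U6_mem_Icc_of_claims hψ hψ1 h₄ h₆ h₈)
  exact ⟨le_trans (by norm_num) h.1, le_trans h.2 (by norm_num)⟩

/-- **R2 row B8c.K at `U = 8`, claim form** (3 nodes: E2 upper at `U = 8`, lower at `U = 12`;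
lower node at `U = 6`): kinetic energy per site `Re⟨ψ, H(1,0) ψ⟩/16 ∈ [-1.1904, -0.7848]`.
[cite: KomaTasaki1994, §1] -/
theorem kineticPerSite_four_U8_mem_Icc_of_claims {ψ : Fock (Orb (FermionTorus 2 4))}
    (hψ : IsGroundState (hamiltonian (fermionTorusGraph 2 4) 1 8) 16 ψ) (hψ1 : star ψ ⬝ᵥ ψ = 1)
    (h₆ : torusLower_mbboot_4x4_U6_N16)
    (h₈ : torusUpper_mbbootE2_4x4_U8_N16)
    (h₁₂ : torusLower_mbboot_4x4_U12_N16) :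
    (expect (hamiltonian (fermionTorusGraph 2 4) 1 0) ψ).re / 16 ∈ Set.Icc (-1.1904 : ℝ) (-0.7848) := by
  constructor
  · have hlo := le_re_expect_kinetic_of_bounds (fermionTorusGraph 2 4) 1 8 hψ hψ1
      (by norm_num : (0 : ℝ) ≤ 6) (by norm_num : (6 : ℝ) < 8) (groundEnergyAt_4x4_U6_N16_ge_decimal h₆)
      (groundEnergyAt_4x4_U8_N16_le_decimal h₈)
    rw [le_div_iff₀ (by norm_num : (0 : ℝ) < 16)]
    refine le_trans ?_ hlo
    norm_num
  · have hup := re_expect_kinetic_le_of_bounds (fermionTorusGraph 2 4) 1 8 hψ hψ1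
      (by norm_num : (0 : ℝ) ≤ 8) (by norm_num : (8 : ℝ) < 12) (groundEnergyAt_4x4_U8_N16_le_decimal h₈)
      (groundEnergyAt_4x4_U12_N16_ge_decimal h₁₂)
    rw [div_le_iff₀ (by norm_num : (0 : ℝ) < 16)]
    refine hup.trans ?_
    norm_num

/-- **R2 row B8c.g at `U = 8`, claim form** (same nodes): bond–spin averaged nearest-neighbour hopping
amplitude `Re(Σ_σ Σ_{x ~ y} ⟨c†_{xσ} c_{yσ}⟩)/128 ∈ [0.0981, 0.1488]`. [cite: LiebLossMccann1993, Theorem eqs. (5)-(6)]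
[cite: KomaTasaki1994, §1] -/
theorem bondAvg_four_U8_mem_Icc_of_claims {ψ : Fock (Orb (FermionTorus 2 4))}
    (hψ : IsGroundState (hamiltonian (fermionTorusGraph 2 4) 1 8) 16 ψ) (hψ1 : star ψ ⬝ᵥ ψ = 1)
    (h₆ : torusLower_mbboot_4x4_U6_N16)
    (h₈ : torusUpper_mbbootE2_4x4_U8_N16)
    (h₁₂ : torusLower_mbboot_4x4_U12_N16) :
    (∑ x : FermionTorus 2 4, ∑ y : FermionTorus 2 4, ∑ σ : Fin 2,
        if (fermionTorusGraph 2 4).Adj x y then expect (creation (orb x σ) * annihilation (orb y σ)) ψ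
        else 0).re / 128 ∈ Set.Icc (0.0981 : ℝ) 0.1488 := by
  have h := bondAvg_four_mem_Icc_of_kinetic (kineticPerSite_four_U8_mem_Icc_of_claims hψ hψ1 h₆ h₈ h₁₂)
  exact ⟨le_trans (by norm_num) h.1, le_trans h.2 (by norm_num)⟩

end Summit.HubbardSuperconductivity.HubbardLadder
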